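import Literature.Computability.Cryptography.ClassBQP
import Literature.Computability.Cryptography.QuantumCircuit
import Literature.Computability.Complexity.Classes
import Literature.Computability.Complexity.ProbabilisticClassesProofs
import Literature.Computability.QuantumComplexity.BQPProofs
import Literature.Computability.QuantumComplexity.ReversibleCliffordT
import Literature.Computability.QuantumComplexity.RevTableauUniform
import HarnessLib

/-!
# `P ⊆ BQP` (Bernstein–Vazirani 1997, Thm. 8.2): reduction to the uniform reversible core

Sibling proof file of `ClassBQP.lean` for the named fact `Literature.Computability.Cryptography.P_subset_BQP`
(D-0014: the fact stays a `def`; this file works towards `P_subset_BQP_holds`).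

The printed source is Bernstein–Vazirani, *Quantum complexity theory*, SIAM J. Comput. 26
(1997), §8.2, p. 1451: "Clearly `EQP ⊆ BQP`. Since reversible TMs are a special case of QTMs,
Bennett's results imply that `P ⊆ EQP` and `BPP ⊆ BQP`." and **Theorem 8.2** (`P ⊆ EQP`), whose
proof is: a polynomial-time deterministic algorithm is turned (synchronization theorem, Thm. 4.14,
p. 1428, resting on Bennett's reversible simulation) into a polynomial-time *reversible* machine
producing `x; M(x)`, which is an exact (error-free) quantum machine. In the uniform-circuit
model of `Literature.Computability.Cryptography.BQP` (Yao 1993) the same proof reads (Arora–Barak 2009, §10.3.7,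
Lemma 10.10 and the remark after it, "Since a classical Turing machine computation running in
`T(n)` steps has an equivalent Boolean circuit of size `O(T log T)` it also follows that
`P ⊆ BQP`"; Nielsen–Chuang 2010, §4.5.5 with §3.2.5 and §3.1.2): a language in `P` is decided by
a polynomial-time uniform family of *classical reversible* circuits (`NOT`, `CNOT`, Toffoli on
fresh ancillas), and these gates are exact Clifford+T words (`X = HSSH`, Toffoli `= H·CCZ·H`,
Nielsen–Chuang Fig. 4.9), so the family maps the basis state `|x⟩|0…0⟩` to a basis state whose
wire `0` carries the answer, which is read with certainty.

## Contents (the decomposition; sizes in `NOTES.md` of the tenure folder)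

* `QCircuit.acceptProb_of_runOn_eq_basisState`: if a circuit sends `|x⟩|0^m⟩` to the basis
  state `|y⟩`, its acceptance probability is `[y₀ = 1]` (exactly `0` or `1`).
* `mem_EQP_of_basisOutput`: a polynomial-time uniform, oracle-free Clifford+T family all of whose
  circuits send `|x⟩|0…0⟩` to a basis state `|out n x⟩` with `(out n x)₀ = [x ∈ L]` puts `L` in
  `EQP` (hence in `BQP`); `mem_EQP_of_revFamily`: the same for families compiled by
  `Literature.Computability.QuantumComplexity.revCompile` from reversible `{NOT, CNOT, Toffoli}` programs
  (`revCompile_mulVec_basisState`).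
* the named fact `uniformReversibleDecider` — **the uniform reversible core of Thm. 8.2**: every
  `L ∈ P` (Mathlib `TM2` model) has such a family; and the literal printed statement
  `P_subset_EQP : Prop := P ⊆ EQP`.
* the reductions `P_subset_EQP_of_uniformReversibleDecider`,
  `P_subset_BQP_of_uniformReversibleDecider`, and, through `P ⊆ BPP`
  (`Literature.Computability.Complexity.P_subset_BPP_holds`) and the sibling reduction
  `Literature.Computability.QuantumComplexity.BPP_subset_BQP_of_uniformReversibleSimulation`, also
  `P_subset_BQP_of_uniformReversibleSimulation` (either reversible core closes `P_subset_BQP`).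
* **the discharge** `uniformReversibleDecider_holds` from the explicit reversible tableau
  simulation of `FinTM2` deciders (`QuantumComplexity/RevTableau.lean`:
  `RevSim.revFamily`, `RevSim.revEval_revProg_zero`) and its uniformity
  (`QuantumComplexity/RevTableauUniform.lean`: `RevSim.revFamily_isUniform`, a generator
  program printing the description); hence `P_subset_EQP_holds` and **`P_subset_BQP_holds`**.

## References

* E. Bernstein, U. Vazirani, *Quantum complexity theory*, SIAM J. Comput. 26 (1997)
  1411–1473, Def. 8.1 (EQP, BQP), §8.2, Thm. 8.2 (`P ⊆ EQP`), p. 1451.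
* S. Arora, B. Barak, *Computational Complexity: A Modern Approach*, CUP 2009, §10.3.7,
  Lemma 10.10 and Cor. 10.11; Thm. 6.6 (circuits for polynomial time).
* M. A. Nielsen, I. L. Chuang, *Quantum Computation and Quantum Information*, CUP 2010,
  §4.5.5 (BQP via uniform circuit families), §3.2.5 (reversible computation), §4.3, Fig. 4.9
  (Toffoli from `H, S, CNOT, T`).
* A. C.-C. Yao, *Quantum circuit complexity*, FOCS 1993 (circuits vs. QTMs).
-/

namespace Literature.Computability.Cryptography

open _root_.Computability Complexity Complexity.Classes Matrix

/-! ### Acceptance probability of a basis-state output -/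

section basisOutput

variable {G : QGateSet} {n m : ℕ}

/-- If a circuit on `n + m` wires maps the input basis state `|x⟩|0^m⟩` to the basis state `|y⟩`,
then the probability of reading `1` on wire `0` is exactly `[y₀ = 1]` — a deterministic
(error-free) answer, as for Bernstein–Vazirani's reversible "EQP machine accepting `L`".
[Bernstein–Vazirani 1997, Def. 8.1 and proof of Thm. 8.2, p. 1451]
[cite: BernsteinVazirani1997, Thm. 8.2 (proof)] -/
theorem QCircuit.acceptProb_of_runOn_eq_basisState (A : Language Bool) (C : QCircuit G (n + m))
    (x : QReg n) (y : QReg (n + m)) (h0 : 0 < n + m)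
    (h : C.runOn A (basisState (padInput x m)) = basisState y) :
    C.acceptProb A x = if y ⟨0, h0⟩ then 1 else 0 := by
  unfold QCircuit.acceptProb
  simp only [h0, dif_pos, h, basisState_apply]
  rw [Finset.sum_eq_single y]
  · by_cases hy : y ⟨0, h0⟩ = true <;> simp [hy]
  · intro z _ hz
    simp [hz]
  · intro hy
    exact absurd (Finset.mem_univ y) hy

/-- Family form of `QCircuit.acceptProb_of_runOn_eq_basisState`: if the circuit for length `|x|`
maps `|x⟩|0…0⟩` to the basis state `|out⟩`, the family accepts `x` with probability
`[out₀ = 1]`. [Bernstein–Vazirani 1997, proof of Thm. 8.2, p. 1451]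
[cite: BernsteinVazirani1997, Thm. 8.2 (proof)] -/
theorem QCircuitFamily.acceptProbOn_of_basisOutput (A : Language Bool) (F : QCircuitFamily G)
    (x : List Bool) (out : QReg (x.length + F.ancillas x.length))
    (h0 : 0 < x.length + F.ancillas x.length)
    (h : (F.circ x.length).runOn A (basisState (padInput x.get (F.ancillas x.length))) =
      basisState out) :
    F.acceptProbOn A x = if out ⟨0, h0⟩ then 1 else 0 :=
  QCircuit.acceptProb_of_runOn_eq_basisState A _ _ out h0 h

end basisOutput

/-! ### Exact decision by classical (basis-preserving) uniform families -/

/-- **Error-free decision by a reversible family.** Let `F` be a polynomial-time uniform,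
oracle-free family of Clifford+T circuits such that every circuit `F.circ n` maps every input
basis state `|x⟩|0…0⟩` to a *basis* state `|out n x⟩` whose wire `0` holds `[x ∈ L]`. Then
`L ∈ EQP` (acceptance probability exactly `1` on `L`, exactly `0` off `L`). This is the last
sentence of the proof of Bernstein–Vazirani's Thm. 8.2 ("This is an EQP machine accepting `L`").
[Bernstein–Vazirani 1997, Thm. 8.2 (proof), p. 1451] [cite: BernsteinVazirani1997, Thm. 8.2 (proof)] -/
theorem mem_EQP_of_basisOutput {L : Language Bool} {F : QCircuitFamily cliffordT}
    (hfree : F.IsOracleFree) (hunif : F.IsUniform)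
    (out : (n : ℕ) → QReg n → QReg (n + F.ancillas n))
    (hout : ∀ (n : ℕ) (x : QReg n),
      (F.circ n).mat *ᵥ basisState (padInput x (F.ancillas n)) = basisState (out n x))
    (hbit : ∀ (n : ℕ) (x : QReg n),
      ∃ h : 0 < n + F.ancillas n, out n x ⟨0, h⟩ = L.boolIndicator (List.ofFn x)) :
    L ∈ EQP := by
  refine ⟨F, hfree, hunif, fun x => ?_⟩
  obtain ⟨h0, hb⟩ := hbit x.length x.get
  have hrun : (F.circ x.length).runOn 0 (basisState (padInput x.get (F.ancillas x.length))) =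
      basisState (out x.length x.get) := hout x.length x.get
  rw [F.acceptProbOn_of_basisOutput 0 x (out x.length x.get) h0 hrun, hb, List.ofFn_get]
  constructor
  · intro hx
    have h1 : L.boolIndicator x = true := by
      unfold Set.boolIndicator; rw [if_pos]; exact hx
    simp [h1]
  · intro hx
    have h1 : L.boolIndicator x = false := by
      unfold Set.boolIndicator; rw [if_neg]; exact hx
    simp [h1]

/-- **Error-free decision by a compiled reversible program.** If `R n` are reversible
`{NOT, CNOT, Toffoli}` programs on `n + anc n` wires whose Clifford+T compilations
(`Literature.Computability.QuantumComplexity.revCompile`: `X = HSSH`, `CNOT`, Toffoli `= H·CCZ·H`) form a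
polynomial-time uniform family, and the classical run of `R n` on `x 0^{anc n}` leaves
`[x ∈ L]` on wire `0`, then `L ∈ EQP`. (Arora–Barak's form of the reversible core: "replace each
Boolean gate by its quantum analog".) [Arora–Barak 2009, §10.3.7, Lemma 10.10;
Bernstein–Vazirani 1997, Thm. 8.2] [cite: AroraBarak2009, §10.3.7 Lemma 10.10] -/
theorem mem_EQP_of_revFamily {L : Language Bool} (anc : ℕ → ℕ)
    (R : (n : ℕ) → List (Literature.Computability.QuantumComplexity.RevOp (n + anc n)))
    (hunif : (⟨anc, fun n => ⟨Literature.Computability.QuantumComplexity.revCompile (R n)⟩⟩ :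
      QCircuitFamily cliffordT).IsUniform)
    (hbit : ∀ (n : ℕ) (x : QReg n), ∃ h : 0 < n + anc n,
      Literature.Computability.QuantumComplexity.revEval (R n) (padInput x (anc n)) ⟨0, h⟩ =
        L.boolIndicator (List.ofFn x)) :
    L ∈ EQP :=
  mem_EQP_of_basisOutput (F := ⟨anc, fun n => ⟨Literature.Computability.QuantumComplexity.revCompile (R n)⟩⟩)
    (fun n => Literature.Computability.QuantumComplexity.revCompile_isOracleFree (R n)) hunif
    (fun n x => Literature.Computability.QuantumComplexity.revEval (R n) (padInput x (anc n)))
    (fun n x => Literature.Computability.QuantumComplexity.revCompile_mulVec_basisState 0 (R n) (padInput x (anc n)))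
    hbit

/-! ### The uniform reversible core (named fact) and the printed statement `P ⊆ EQP` -/

/-- **Uniform reversible simulation of polynomial time** — the core of Bernstein–Vazirani's
Thm. 8.2 (`P ⊆ EQP`) in the uniform circuit model: for every `L ∈ P` (deterministic polynomial
time on Mathlib's multi-stack machines `Turing.FinTM2`, `Literature.Computability.Complexity.Classes.P`) there is a
polynomial-time uniform, oracle-free family of Clifford+T circuits each of which maps every
input basis state `|x⟩|0…0⟩` to a *basis* state `|out n x⟩` (a classical reversible
computation: permutation of the computational basis) whose wire `0` holds the bit `[x ∈ L]`.
Printed proof: a polynomial-time deterministic machine is made reversible (Bennett 1973) and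
synchronized (BV97, Thm. 4.14), producing `x; M(x)`; circuit form: the machine's computation
tableau is a polynomial-time uniform polynomial-size Boolean circuit (Arora–Barak 2009, Thm. 6.6
and §6.2), whose gates are replaced by `NOT`/`CNOT`/Toffoli gates on fresh wires (Lemma 10.10),
which are exact Clifford+T words (Nielsen–Chuang 2010, Fig. 4.9). Discharge route in this
library: the explicit layered reversible tableau of a `FinTM2` decider (every configuration of
the run written one-hot into fresh wires by `NOT`/`CNOT`/Toffoli gates;
`Literature.Computability.QuantumComplexity.RevSim.revFamily`, `QuantumComplexity/RevTableau.lean`, on top of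
`Literature.CplxCore.FinTM2Sim` and `Literature.Computability.QuantumComplexity.revCompile`), plus a generator program
(`Literature.Computability.Complexity.GStmt`, `GenPrograms.lean`) printing its description.
[Bernstein–Vazirani 1997, §8.2, Thm. 8.2 (proof), p. 1451; Arora–Barak 2009, §10.3.7,
Lemma 10.10 and remark (`P ⊆ BQP`), Thm. 6.6] [cite: BernsteinVazirani1997, Thm. 8.2 (proof)] -/
def uniformReversibleDecider : Prop :=
  ∀ L ∈ P, ∃ F : QCircuitFamily cliffordT, F.IsOracleFree ∧ F.IsUniform ∧
    ∃ out : (n : ℕ) → QReg n → QReg (n + F.ancillas n),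
      (∀ (n : ℕ) (x : QReg n),
        (F.circ n).mat *ᵥ basisState (padInput x (F.ancillas n)) = basisState (out n x)) ∧
      ∀ (n : ℕ) (x : QReg n),
        ∃ h : 0 < n + F.ancillas n, out n x ⟨0, h⟩ = L.boolIndicator (List.ofFn x)

/-- **`P ⊆ EQP`** (Bernstein–Vazirani 1997, Thm. 8.2), the printed statement behind
`P_subset_BQP`: deterministic polynomial time is contained in *exact* (error-free) quantum
polynomial time — here over uniform Clifford+T circuit families (`Literature.Computability.Cryptography.EQP`).
[Bernstein–Vazirani 1997, §8.2, Thm. 8.2, p. 1451] [cite: BernsteinVazirani1997, Thm. 8.2] -/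
def P_subset_EQP : Prop :=
  P ⊆ EQP

/-- `P ⊆ EQP` from the uniform reversible core (the last step of the printed proof: the
reversible family *is* an EQP device, `mem_EQP_of_basisOutput`).
[Bernstein–Vazirani 1997, Thm. 8.2 (proof), p. 1451] [cite: BernsteinVazirani1997, Thm. 8.2 (proof)] -/
theorem P_subset_EQP_of_uniformReversibleDecider (h : uniformReversibleDecider) :
    P_subset_EQP := by
  intro L hL
  obtain ⟨F, hfree, hunif, out, hout, hbit⟩ := h L hL
  exact mem_EQP_of_basisOutput hfree hunif out hout hbit

/-- **`P ⊆ BQP` from the uniform reversible core**: `P ⊆ EQP ⊆ BQP`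
(`P_subset_EQP_of_uniformReversibleDecider`, `EQP_subset_BQP`). [Bernstein–Vazirani 1997,
§8.2, p. 1451 ("Clearly EQP ⊆ BQP … P ⊆ EQP"), Thm. 8.2] [cite: BernsteinVazirani1997, Thm. 8.2] -/
theorem P_subset_BQP_of_uniformReversibleDecider (h : uniformReversibleDecider) :
    P_subset_BQP :=
  fun _ hL => EQP_subset_BQP (P_subset_EQP_of_uniformReversibleDecider h hL)

/-- **`P ⊆ BQP` from the reversible core of `BPP ⊆ BQP`**: `P ⊆ BPP`
(`Literature.Computability.Complexity.P_subset_BPP_holds`, Gill 1977) and `BPP ⊆ BQP` from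
`Literature.Computability.QuantumComplexity.uniformReversibleSimulation`
(`Literature.Computability.QuantumComplexity.BPP_subset_BQP_of_uniformReversibleSimulation`, Bernstein–Vazirani 1997,
Thm. 8.3). Either reversible core therefore closes `P_subset_BQP`.
[Bernstein–Vazirani 1997, §8.2, Thms. 8.2–8.3, p. 1451] [cite: BernsteinVazirani1997, §8.2 Thm. 8.3] -/
theorem P_subset_BQP_of_uniformReversibleSimulation
    (h : Literature.Computability.QuantumComplexity.uniformReversibleSimulation) : P_subset_BQP :=
  fun _ hL => Literature.Computability.QuantumComplexity.BPP_subset_BQP_of_uniformReversibleSimulation h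
    (P_subset_BPP_holds hL)

/-! ### Discharge: the uniform reversible core, `P ⊆ EQP`, `P ⊆ BQP` -/

/-- The polynomial running time `c·nᵏ + c` is at most `(n+2)^(k+c)`. [folklore] -/
theorem time_le_pow_add (c k n : ℕ) : c * n ^ k + c ≤ (n + 2) ^ (k + c) := by
  rcases Nat.eq_zero_or_pos c with rfl | hc
  · simp
  have h1 : n ^ k ≤ (n + 2) ^ k := Nat.pow_le_pow_left (by omega) k
  have h2 : 1 ≤ (n + 2) ^ k := Nat.one_le_pow _ _ (by omega)
  have h3 : ∀ m : ℕ, 2 * m ≤ 2 ^ m := fun m => by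
    induction m with
    | zero => simp
    | succ m ih =>
      have : 1 ≤ 2 ^ m := Nat.one_le_two_pow
      rw [pow_succ]; omega
  have h4 : 2 * c ≤ (n + 2) ^ c := (h3 c).trans (Nat.pow_le_pow_left (by omega) c)
  calc c * n ^ k + c ≤ c * (n + 2) ^ k + c * (n + 2) ^ k :=
        Nat.add_le_add (Nat.mul_le_mul_left _ h1) (by simpa using Nat.mul_le_mul_left c h2)
    _ = (n + 2) ^ k * (2 * c) := by ring
    _ ≤ (n + 2) ^ k * (n + 2) ^ c := Nat.mul_le_mul_left _ h4
    _ = (n + 2) ^ (k + c) := by rw [pow_add]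

/-- **The uniform reversible core of Bernstein–Vazirani's Thm. 8.2, discharged.** For `L ∈ P`,
decided by the `FinTM2` machine `M` in time `c·nᵏ + c ≤ (n+2)^(k+c)`, the tableau family
`RevSim.revFamily (k + c) M` (`QuantumComplexity/RevTableau.lean`: input layer, `(n+2)^(k+c)`
reversible simulation steps written into fresh wires by `NOT`/`CNOT`/Toffoli gates compiled to
Clifford+T, read-out onto wire `0`) is oracle-free (`revCompile_isOracleFree`), polynomial-time
uniform (`RevSim.revFamily_isUniform`, `RevTableauUniform.lean`), maps `|x⟩|0…0⟩` to the basis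
state `|revEval (revProg n) (x 0…0)⟩` (`revCompile_mulVec_basisState`) whose wire `0` is
`[x ∈ L]` (`RevSim.revEval_revProg_zero`). [Bernstein–Vazirani 1997, §8.2, Thm. 8.2 (proof),
p. 1451; Arora–Barak 2009, §10.3.7 Lemma 10.10, Thm. 6.6] [cite: BernsteinVazirani1997, Thm. 8.2 (proof)] -/
theorem uniformReversibleDecider_holds : uniformReversibleDecider := by
  intro L hL
  simp only [P, DTIME, TimeClass, Set.mem_iUnion, Set.mem_setOf_eq] at hL
  obtain ⟨k, c, M, hM⟩ := hL
  refine ⟨Literature.Computability.QuantumComplexity.RevSim.revFamily (k + c) M,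
    fun n => Literature.Computability.QuantumComplexity.revCompile_isOracleFree _,
    Literature.Computability.QuantumComplexity.RevSim.revFamily_isUniform (k + c) M,
    fun n x => Literature.Computability.QuantumComplexity.revEval (Literature.Computability.QuantumComplexity.RevSim.revProg (k + c) M n)
      (padInput x (Literature.Computability.QuantumComplexity.RevSim.ancN M.tm (k + c) n)),
    fun n x => Literature.Computability.QuantumComplexity.revCompile_mulVec_basisState 0 _ _,
    fun n x => ⟨Literature.Computability.QuantumComplexity.RevSim.NN_pos (k + c) M n, ?_⟩⟩
  have hx := hM (List.ofFn x)
  simp only [id, List.length_ofFn] at hx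
  exact Literature.Computability.QuantumComplexity.RevSim.revEval_revProg_zero (k + c) M n x _ (hx.mono (time_le_pow_add c k n))

/-- **`P ⊆ EQP`** (Bernstein–Vazirani 1997, Thm. 8.2), discharged: the uniform reversible core
`uniformReversibleDecider_holds` fed to `P_subset_EQP_of_uniformReversibleDecider`.
[Bernstein–Vazirani 1997, §8.2, Thm. 8.2, p. 1451] [cite: BernsteinVazirani1997, Thm. 8.2] -/
theorem P_subset_EQP_holds : P_subset_EQP :=
  P_subset_EQP_of_uniformReversibleDecider uniformReversibleDecider_holds

/-- **`P ⊆ BQP`** (Bernstein–Vazirani 1997, §8.2: Thm. 8.2 `P ⊆ EQP` and "clearly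
`EQP ⊆ BQP`"), the discharge of the named fact `Literature.Computability.Cryptography.P_subset_BQP` over the
tree's uniform Clifford+T circuit model: every language decidable in deterministic polynomial
time on Mathlib's `FinTM2` machines is decided with certainty by a polynomial-time uniform family
of reversible (hence quantum) circuits. [Bernstein–Vazirani 1997, §8.2, Thm. 8.2, p. 1451;
Arora–Barak 2009, §10.3.7, Lemma 10.10 and the remark after it]
[cite: BernsteinVazirani1997, Thm. 8.2] -/
theorem P_subset_BQP_holds : P_subset_BQP :=
  P_subset_BQP_of_uniformReversibleDecider uniformReversibleDecider_holds

end Literature.Computability.Cryptography
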